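import Literature.Analysis.FluidPDE.PeriodicGalileanFrameBlowup
import Mathlib.MeasureTheory.Group.Measure
import HarnessLib

/-!
# The Galilean frame slot on `ℝ³`, family file: uniform accelerating streams are classical
# Navier–Stokes solutions (Majda–Bertozzi 2002 §1.2; Tao 2013 §3 eq. (galilean); Fefferman (4), (7))

Support file (all results proved, standard axioms; no definitions) of the barrier catalogue entry
`Literature.Barriers.NavierStokesRegularity.GalileanFrameSlot` (file `GalileanFrameSlot.lean`,
which carries the structured BARRIER block, the sources, the zero-datum consequences and the cell
rows it bears on). On any finite-dimensional real inner-product space `E` (so `ℝ³`), for every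
viscosity `ν` and every SMOOTH velocity profile `a : ℝ → E`, the UNIFORM STREAM
`u(t, y) = a(t)` with pressure `p(t, y) = −⟪a′(t), y⟫` — Tao's Galilean family
[Tao2013Localisation, §3 eq. (galilean)] `u(t, x − ∫v) + v(t)`, `p(t, x − ∫v) − x·v′(t)` applied to
the rest state; Galilean invariance [MajdaBertozzi2002, §1.2]; tree
`IsClassicalNSSolutionOn.galileanBoost`, `isClassicalNSSolutionOn_acceleratedRest` — is an unforced
classical solution on every time set of unique differentiability (`isClassicalNSSolutionOn_stream`)
and satisfies Fefferman's (1)(2)(3)(6) on `E × [0,∞)` (`isNavierStokesSolution_stream`). Along it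
`∂ₜu = −∇p = a′(t)` takes every vector value while `(u·∇)u`, `Δu`, `div u`, `Du`, `∇(|u|²/2)`
vanish. Proved consequences: THE SLOT `slot` — a pointwise relation among
`(u, ∂ₜu, (u·∇)u, Δu, ∇p, ∇(|u|²/2))` valid for all unforced classical solutions holds at
`(c, b, 0, 0, −b, 0)` — with `no_pointwise_bernoulli_law`, `materialDeriv_onto`,
`no_constant_inertial_force`, `no_autonomous_time_derivative_law`; and what removes the moving
streams from Clay (A)/(C) [FeffermanClay2006, (4) (7)]: `not_hasBoundedEnergy_stream`,
`eq_zero_of_hasRapidSpatialDecay_stream`. The stream is written inline as `fun t _ => a t`,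
`fun t y => -⟪deriv a t, y⟫` throughout (no new vocabulary).

## References

* [MajdaBertozzi2002] A. J. Majda, A. L. Bertozzi, *Vorticity and Incompressible Flow*, CUP 2002, §1.2.
* [Tao2013Localisation] T. Tao, Anal. PDE 6 (2013) 25–107 = arXiv:1108.1165, §3 eq. (galilean).
* [FeffermanClay2006] C. L. Fefferman, CMI problem description, (A)/(C) with (4), (6), (7).

WHAT THIS IS NOT: not a claim about NS regularity or blow-up; not a claim about any author beyond the
typed locator.
-/

noncomputable section

open Set Function Filter InnerProductSpace MeasureTheory
open scoped ContDiff RealInnerProductSpace Topology Laplacian ENNReal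

namespace Literature.Barriers.NavierStokesRegularity

open Literature.Analysis.FluidPDE

namespace FrameSlot

variable {E : Type*} [NormedAddCommGroup E] [InnerProductSpace ℝ E] [FiniteDimensional ℝ E]

/-! ### Kinematics of a spatially constant field -/

omit [FiniteDimensional ℝ E] in
/-- The convective term of a spatially constant field vanishes: `(c·∇)c = 0`.
[cite: MajdaBertozzi2002, §1.2] -/
theorem convect_const (c : E) (y : E) : convect (fun _ : E => c) (fun _ : E => c) y = 0 := by
  rw [convect_apply, fderiv_const_apply]
  rfl

/-- The Laplacian of a constant field vanishes. [cite: MajdaBertozzi2002, §1.2] -/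
theorem laplacian_const_apply (c : E) (y : E) : (Δ (fun _ : E => c)) y = 0 := by
  rw [InnerProductSpace.laplacian_const]
  rfl

/-- The gradient of the linear pressure `y ↦ −⟪b, y⟫` is `−b` (a uniform pressure gradient).
[cite: Tao2013Localisation, §3 eq. (galilean)] -/
theorem gradient_neg_inner_left (b y : E) : gradient (fun z : E => -⟪b, z⟫) y = -b := by
  have h0 : (fun z : E => -⟪b, z⟫) = fun z : E => ⟪-b, z⟫ := by
    funext z
    rw [inner_neg_left]
  have h1 : HasFDerivAt (fun z : E => ⟪-b, z⟫) (toDual ℝ E (-b)) y := by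
    have : (fun z : E => ⟪-b, z⟫) = toDual ℝ E (-b) := by funext z; rfl
    rw [this]
    exact (toDual ℝ E (-b)).hasFDerivAt
  rw [h0]
  unfold gradient
  rw [h1.fderiv, LinearIsometryEquiv.symm_apply_apply]

omit [FiniteDimensional ℝ E] in
/-- The one-sided time derivative of the uniform stream `u(t, y) = a(t)` within a time set `S`,
at a point of unique differentiability where `a` is differentiable, is `a′(t)` — ANY vector, by
choice of the profile. [cite: Tao2013Localisation, §3 eq. (galilean)] -/
theorem timeDerivWithin_stream {S : Set ℝ} {a : ℝ → E} {t : ℝ} (ha : DifferentiableAt ℝ a t)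
    (hS : UniqueDiffWithinAt ℝ S t) (y : E) :
    timeDerivWithin S (fun s (_ : E) => a s) t y = deriv a t := by
  rw [timeDerivWithin_apply]
  exact ha.hasDerivAt.hasDerivWithinAt.derivWithin hS

/-! ### The uniform accelerating stream is a classical solution -/

/-- **The uniform accelerating stream is an unforced classical Navier–Stokes solution** on every
time set `S` of unique differentiability, for every smooth profile `a : ℝ → E` and every viscosity
`ν`: `u(t, y) = a(t)`, `p(t, y) = −⟪a′(t), y⟫` satisfy `∂ₜu + (u·∇)u = a′ = νΔu − ∇p`,
`div u = 0` (Tao 2013 §3 eq. (galilean) applied to the rest state; Galilean invariance,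
Majda–Bertozzi §1.2; tree `IsClassicalNSSolutionOn.galileanBoost`).
[cite: Tao2013Localisation, §3 eq. (galilean)] -/
theorem isClassicalNSSolutionOn_stream {S : Set ℝ} (hS : UniqueDiffOn ℝ S) {a : ℝ → E}
    (ha : ContDiff ℝ ∞ a) (ν : ℝ) :
    IsClassicalNSSolutionOn S ν 0 (fun t (_ : E) => a t) (fun t y => -⟪deriv a t, y⟫) where
  smooth_velocity := by
    have h : ContDiff ℝ ∞ (fun z : ℝ × E => a z.1) := ha.comp contDiff_fst
    exact isSmoothSpaceTimeOn_of_contDiff h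
  smooth_pressure := by
    have ha' : ContDiff ℝ ∞ (deriv a) := contDiff_deriv_of_contDiff_infty ha
    have h : ContDiff ℝ ∞ (fun z : ℝ × E => -⟪deriv a z.1, z.2⟫) :=
      ((ha'.comp contDiff_fst).inner ℝ contDiff_snd).neg
    exact isSmoothSpaceTimeOn_of_contDiff h
  momentum t ht y := by
    rw [timeDerivWithin_stream ((ha.differentiable (by simp)) t) (hS t ht)]
    show deriv a t + convect (fun _ : E => a t) (fun _ : E => a t) y =
      ν • (Δ (fun _ : E => a t)) y - gradient (fun z : E => -⟪deriv a t, z⟫) y + (0 : ℝ → E → E) t y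
    rw [convect_const, laplacian_const_apply, gradient_neg_inner_left]
    simp
  divFree t _ y := by
    -- a constant field is divergence free (tree: `HasWeakDerivAlong.divergence_const_field`)
    change VectorCalculus.divergence (fun _ : E => a t) y = 0
    simp [VectorCalculus.divergence]

/-- The uniform stream solves the unforced system classically on all of space-time.
[cite: Tao2013Localisation, §3 eq. (galilean)] -/
theorem isClassicalNSSolutionOn_stream_univ {a : ℝ → E} (ha : ContDiff ℝ ∞ a) (ν : ℝ) :
    IsClassicalNSSolutionOn univ ν 0 (fun t (_ : E) => a t) (fun t y => -⟪deriv a t, y⟫) :=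
  isClassicalNSSolutionOn_stream uniqueDiffOn_univ ha ν

/-- The uniform stream solves the unforced system classically on `E × [0, T)` (the continuation
slab). [cite: Tao2013Localisation, §3 eq. (galilean)] -/
theorem isClassicalNSSolutionOn_stream_Ico {a : ℝ → E} (ha : ContDiff ℝ ∞ a) (ν T : ℝ) :
    IsClassicalNSSolutionOn (Ico 0 T) ν 0 (fun t (_ : E) => a t) (fun t y => -⟪deriv a t, y⟫) :=
  isClassicalNSSolutionOn_stream (uniqueDiffOn_Ico 0 T) ha ν

/-- **Clay-predicate form**: the uniform stream satisfies Fefferman's (1), (2), (3), (6) on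
`E × [0,∞)` with `f ≡ 0` and datum `u₀ ≡ a(0)` (bridge `isNavierStokesSolution_and_smooth_iff`).
[cite: FeffermanClay2006, eqs. (1) (2) (3) (6)] -/
theorem isNavierStokesSolution_stream {a : ℝ → E} (ha : ContDiff ℝ ∞ a) (ν : ℝ) :
    IsNavierStokesSolution ν 0 (fun _ => a 0) (fun t (_ : E) => a t) (fun t y => -⟪deriv a t, y⟫) ∧
      IsSmoothOnHalfSpace (fun t (_ : E) => a t) ∧
        IsSmoothOnHalfSpace (fun (t : ℝ) (y : E) => -⟪deriv a t, y⟫) :=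
  isNavierStokesSolution_and_smooth_iff.2 ⟨isClassicalNSSolutionOn_stream (uniqueDiffOn_Ici 0) ha ν, rfl⟩

/-! ### The slot: every universally asserted pointwise law is tested at `(c, b, 0, 0, −b, 0)` -/

omit [FiniteDimensional ℝ E] in
/-- The affine profile `a(t) = c + (t − t₀) b` is smooth. [cite: MajdaBertozzi2002, §1.2] -/
theorem contDiff_affineProfile (c b : E) (t₀ : ℝ) :
    ContDiff ℝ ∞ (fun t : ℝ => c + (t - t₀) • b) :=
  contDiff_const.add ((contDiff_id.sub contDiff_const).smul contDiff_const)

omit [FiniteDimensional ℝ E] in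
/-- The affine profile has derivative `b` everywhere. [cite: MajdaBertozzi2002, §1.2] -/
theorem hasDerivAt_affineProfile (c b : E) (t₀ t : ℝ) :
    HasDerivAt (fun s : ℝ => c + (s - t₀) • b) b t := by
  have h := (((hasDerivAt_id t).sub_const t₀).smul_const b).const_add c
  simpa using h

/-- **THE FRAME SLOT.** Let `R` be any relation among the point values
`(u, ∂ₜu, (u·∇)u, Δu, ∇p, ∇(|u|²/2))` and suppose it holds at every `(t, y)`, `t ∈ S`, for EVERY
unforced classical solution `(u, p)` with viscosity `ν` on a time set `S` of unique
differentiability containing `t₀`. Then `R c b 0 0 (−b) 0` for all vectors `b, c`: the uniform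
stream with profile `a(t) = c + (t − t₀) b` realises these values at `(t₀, y)`. Hence a pointwise
law tying `∂ₜu` or `∇p` to `u, Du, Δu, ∇|u|²` that is not satisfied with `∂ₜu = −∇p` FREE is false
for classical solutions (Galilean / accelerated-frame covariance, Majda–Bertozzi §1.2, Tao §3).
[cite: MajdaBertozzi2002, §1.2] -/
theorem slot {S : Set ℝ} (hS : UniqueDiffOn ℝ S) {t₀ : ℝ} (ht₀ : t₀ ∈ S) {ν : ℝ}
    {R : E → E → E → E → E → E → Prop}
    (hR : ∀ (u : ℝ → E → E) (p : ℝ → E → ℝ), IsClassicalNSSolutionOn S ν 0 u p →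
      ∀ t ∈ S, ∀ y, R (u t y) (timeDerivWithin S u t y) (convect (u t) (u t) y) ((Δ (u t)) y)
        (gradient (p t) y) (gradient (fun z => ‖u t z‖ ^ 2 / 2) y))
    (b c : E) : R c b 0 0 (-b) 0 := by
  have ha : ContDiff ℝ ∞ (fun t : ℝ => c + (t - t₀) • b) := contDiff_affineProfile c b t₀
  have hd : deriv (fun t : ℝ => c + (t - t₀) • b) t₀ = b := (hasDerivAt_affineProfile c b t₀ t₀).deriv
  have h := hR _ _ (isClassicalNSSolutionOn_stream hS ha ν) t₀ ht₀ 0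
  rw [timeDerivWithin_stream (hasDerivAt_affineProfile c b t₀ t₀).differentiableAt (hS t₀ ht₀),
    hd] at h
  simp only [sub_self, zero_smul, add_zero] at h
  rw [convect_const, laplacian_const_apply, gradient_neg_inner_left, gradient_fun_const] at h
  exact h

/-- **No pointwise Bernoulli pressure law**: `∇p = −∇(|u|²/2)` (the shape of
`Literature.Claims.NS.Ershkov2015.Step_24` with potential `φ ≡ 0`) fails for some unforced
classical solution on any time set of unique differentiability with a point (`E` nontrivial): the
stream `u = (t − t₀) b` has `∇p = −b ≠ 0 = −∇(|u|²/2)`. [cite: MajdaBertozzi2002, §1.2] -/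
theorem no_pointwise_bernoulli_law [Nontrivial E] {S : Set ℝ} (hS : UniqueDiffOn ℝ S) {t₀ : ℝ}
    (ht₀ : t₀ ∈ S) (ν : ℝ) :
    ¬ ∀ (u : ℝ → E → E) (p : ℝ → E → ℝ), IsClassicalNSSolutionOn S ν 0 u p →
        ∀ t ∈ S, ∀ y, gradient (p t) y = -gradient (fun z => ‖u t z‖ ^ 2 / 2) y := by
  intro h
  obtain ⟨b, hb⟩ := exists_ne (0 : E)
  have := slot hS ht₀ (R := fun _ _ _ _ gp gk => gp = -gk) (fun u p hup t ht y => h u p hup t ht y) b 0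
  exact hb (by simpa using this)

/-- **The inertial term `∂ₜu + (u·∇)u` takes every vector value** at `(t₀, 0)` across unforced
classical solutions (so no «the force per volume is one constant» axiom of the shape of
`Literature.Claims.NS.UmarBisandu2025.Step1_MinimumForce` can hold). [cite: MajdaBertozzi2002, §1.2] -/
theorem materialDeriv_onto {S : Set ℝ} (hS : UniqueDiffOn ℝ S) {t₀ : ℝ} (ht₀ : t₀ ∈ S) (ν : ℝ)
    (b : E) : ∃ (u : ℝ → E → E) (p : ℝ → E → ℝ), IsClassicalNSSolutionOn S ν 0 u p ∧
      timeDerivWithin S u t₀ 0 + convect (u t₀) (u t₀) 0 = b := by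
  refine ⟨fun t _ => (0 : E) + (t - t₀) • b, fun t y => -⟪deriv (fun s : ℝ => (0 : E) + (s - t₀) • b) t, y⟫,
    isClassicalNSSolutionOn_stream hS (contDiff_affineProfile 0 b t₀) ν, ?_⟩
  rw [timeDerivWithin_stream (hasDerivAt_affineProfile 0 b t₀ t₀).differentiableAt (hS t₀ ht₀),
    (hasDerivAt_affineProfile 0 b t₀ t₀).deriv]
  show b + convect (fun _ : E => (0 : E) + (t₀ - t₀) • b) (fun _ : E => (0 : E) + (t₀ - t₀) • b) 0 = b
  rw [convect_const, add_zero]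

/-- **No constant inertial force**: there is no single vector `F` with `∂ₜu + (u·∇)u = F` for all
unforced classical solutions (`E` nontrivial). [cite: MajdaBertozzi2002, §1.2] -/
theorem no_constant_inertial_force [Nontrivial E] {S : Set ℝ} (hS : UniqueDiffOn ℝ S) {t₀ : ℝ}
    (ht₀ : t₀ ∈ S) (ν : ℝ) :
    ¬ ∃ F : E, ∀ (u : ℝ → E → E) (p : ℝ → E → ℝ), IsClassicalNSSolutionOn S ν 0 u p →
        ∀ t ∈ S, ∀ y, timeDerivWithin S u t y + convect (u t) (u t) y = F := by
  rintro ⟨F, hF⟩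
  obtain ⟨b, hb⟩ := exists_ne (0 : E)
  have h0 := slot hS ht₀ (R := fun _ ut uc _ _ _ => ut + uc = F)
    (fun u p hup t ht y => hF u p hup t ht y) 0 0
  have h1 := slot hS ht₀ (R := fun _ ut uc _ _ _ => ut + uc = F)
    (fun u p hup t ht y => hF u p hup t ht y) b 0
  simp only [add_zero] at h0 h1
  exact hb (h1.trans h0.symm)

/-- **`∂ₜu` is not a function of the spatial jet**: there is no `Φ` with
`∂ₜu(t,y) = Φ(u(t,y), Du(t,y), Δu(t,y))` for all unforced classical solutions (`E` nontrivial) —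
the shape of every «the time derivative / the pressure is determined pointwise by the velocity
field» law (e.g. `∂ₜu = −∇(H + |u|²/2) + νΔu` with `H ≡ 0`). Two streams through the same point
value `c` with `Du = 0`, `Δu = 0` have different accelerations. [cite: MajdaBertozzi2002, §1.2] -/
theorem no_autonomous_time_derivative_law [Nontrivial E] {S : Set ℝ} (hS : UniqueDiffOn ℝ S)
    {t₀ : ℝ} (ht₀ : t₀ ∈ S) (ν : ℝ) :
    ¬ ∃ Φ : E → (E →L[ℝ] E) → E → E, ∀ (u : ℝ → E → E) (p : ℝ → E → ℝ),
        IsClassicalNSSolutionOn S ν 0 u p →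
          ∀ t ∈ S, ∀ y, timeDerivWithin S u t y = Φ (u t y) (fderiv ℝ (u t) y) ((Δ (u t)) y) := by
  rintro ⟨Φ, hΦ⟩
  obtain ⟨b, hb⟩ := exists_ne (0 : E)
  have key : ∀ b' : E, b' = Φ 0 0 0 := by
    intro b'
    have ha := contDiff_affineProfile (0 : E) b' t₀
    have h := hΦ _ _ (isClassicalNSSolutionOn_stream hS ha ν) t₀ ht₀ 0
    rw [timeDerivWithin_stream (hasDerivAt_affineProfile 0 b' t₀ t₀).differentiableAt (hS t₀ ht₀),
      (hasDerivAt_affineProfile 0 b' t₀ t₀).deriv] at h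
    simp only [sub_self, zero_smul, add_zero] at h
    rw [fderiv_const_apply, laplacian_const_apply] at h
    exact h
  exact hb ((key b).trans (key 0).symm)

/-! ### What excludes the family from Clay (A)/(C): exactly (7), and (4) for the datum -/

/-- **A uniform stream that moves at some time `t ≥ 0` has infinite energy**:
`∫ |u(x,t)|² dx = ∞`, so it violates Fefferman's (7) (`E` nontrivial; Lebesgue measure of `E` is
infinite). [cite: FeffermanClay2006, eq. (7)] -/
theorem not_hasBoundedEnergy_stream [Nontrivial E] [MeasurableSpace E] [BorelSpace E] {a : ℝ → E}
    {t : ℝ} (ht : 0 ≤ t) (hat : a t ≠ 0) : ¬ HasBoundedEnergy (fun s (_ : E) => a s) := by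
  rintro ⟨C, hC, hbound⟩
  have h := hbound t ht
  have hconst : ∫⁻ _ : E, ‖a t‖ₑ ^ 2 = ‖a t‖ₑ ^ 2 * volume (univ : Set E) := by
    rw [lintegral_const]
  have hvol : volume (univ : Set E) = ⊤ := measure_univ_of_isAddLeftInvariant _
  have hpos : ‖a t‖ₑ ^ 2 ≠ 0 := pow_ne_zero 2 (by simpa using hat)
  have h' : ∫⁻ _ : E, ‖a t‖ₑ ^ 2 ≤ C := h
  rw [hconst, hvol, ENNReal.mul_top hpos] at h'
  exact (lt_irrefl _) ((top_le_iff.1 h').symm ▸ hC)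

omit [FiniteDimensional ℝ E] in
/-- **A uniform-stream datum satisfies Fefferman's decay (4) only if it is the zero datum.**
[cite: FeffermanClay2006, eq. (4)] -/
theorem eq_zero_of_hasRapidSpatialDecay_stream [Nontrivial E] {c : E}
    (h : HasRapidSpatialDecay (fun _ : E => c)) : c = 0 := by
  by_contra hne
  obtain ⟨C, hC⟩ := h 0 1
  obtain ⟨w, hw⟩ := exists_ne (0 : E)
  have hw' : 0 < ‖w‖ := norm_pos_iff.2 hw
  have hc' : 0 < ‖c‖ := norm_pos_iff.2 hne
  -- take `x = s • w` with `s` large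
  set s : ℝ := (|C| + 1) / (‖w‖ * ‖c‖) with hs
  have hspos : 0 < s := by rw [hs]; positivity
  have hx := hC (s • w)
  rw [pow_one, norm_iteratedFDeriv_zero] at hx
  have hnorm : ‖s • w‖ = s * ‖w‖ := by rw [norm_smul, Real.norm_of_nonneg hspos.le]
  rw [hnorm] at hx
  have : (1 + s * ‖w‖) * ‖c‖ = ‖c‖ + (|C| + 1) := by
    rw [hs]
    field_simp
  rw [this] at hx
  linarith [le_abs_self C, hc'.le]

/-! ### The pressure gradient is not a pointwise function of the velocity jet (appended) -/

/-- **`∇p` takes every vector value at a point across unforced classical solutions sharing the same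
velocity jet `(u, Du, Δu) = (c, 0, 0)` there**: the stream with profile `a(t) = c − (t − t₀) g` has
`u(t₀) = c`, `Du = 0`, `Δu = 0` and `∇p(t₀, ·) = g`. [cite: Tao2013Localisation, §3 eq. (galilean)] -/
theorem pressureGradient_onto {S : Set ℝ} (hS : UniqueDiffOn ℝ S) (t₀ ν : ℝ)
    (c g : E) : ∃ (u : ℝ → E → E) (p : ℝ → E → ℝ), IsClassicalNSSolutionOn S ν 0 u p ∧
      u t₀ 0 = c ∧ fderiv ℝ (u t₀) 0 = 0 ∧ (Δ (u t₀)) 0 = 0 ∧ gradient (p t₀) 0 = g := by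
  refine ⟨fun t _ => c + (t - t₀) • (-g), fun t y => -⟪deriv (fun s : ℝ => c + (s - t₀) • (-g)) t, y⟫,
    isClassicalNSSolutionOn_stream hS (contDiff_affineProfile c (-g) t₀) ν, ?_, ?_, ?_, ?_⟩
  · simp
  · exact fderiv_const_apply _
  · exact laplacian_const_apply _ _
  · show gradient (fun y : E => -⟪deriv (fun s : ℝ => c + (s - t₀) • (-g)) t₀, y⟫) 0 = g
    rw [(hasDerivAt_affineProfile c (-g) t₀ t₀).deriv, gradient_neg_inner_left, neg_neg]

/-- **No pointwise pressure law `∇p = Π(u, Du, Δu)`** for all unforced classical solutions (`E`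
nontrivial): the pressure gradient is NOT determined by the local velocity jet — it is the frame
acceleration, a free vector (the non-locality of the pressure at its crudest; «pressure computed
pointwise from the velocity» shapes). [cite: Tao2013Localisation, §3 eq. (galilean)] -/
theorem no_autonomous_pressure_law [Nontrivial E] {S : Set ℝ} (hS : UniqueDiffOn ℝ S) {t₀ : ℝ}
    (ht₀ : t₀ ∈ S) (ν : ℝ) :
    ¬ ∃ Pr : E → (E →L[ℝ] E) → E → E, ∀ (u : ℝ → E → E) (p : ℝ → E → ℝ),
        IsClassicalNSSolutionOn S ν 0 u p →
          ∀ t ∈ S, ∀ y, gradient (p t) y = Pr (u t y) (fderiv ℝ (u t) y) ((Δ (u t)) y) := by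
  rintro ⟨Pr, hPr⟩
  obtain ⟨g, hg⟩ := exists_ne (0 : E)
  have key : ∀ g' : E, g' = Pr 0 0 0 := by
    intro g'
    obtain ⟨u, p, hup, hu, hDu, hLu, hgp⟩ := pressureGradient_onto hS t₀ ν 0 g'
    have h := hPr u p hup t₀ ht₀ 0
    rw [hgp, hu, hDu, hLu] at h
    exact h
  exact hg ((key g).trans (key 0).symm)

end FrameSlot

end Literature.Barriers.NavierStokesRegularity

end
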